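import Literature.AlgebraicGeometry.Resolution.AlterationsSemiStableResolution
import Literature.AlgebraicGeometry.Resolution.NormalCrossingsBlowupStepReduction
import Literature.AlgebraicGeometry.Resolution.NormalCrossingsBlowupStepReductionProofs
import HarnessLib

/-!
# De Jong 1996, 2.4 (normal crossings → strict normal crossings by blowing up): assembly of the proof

Topic: `Literature/AlgebraicGeometry/Resolution`. Proofs file for the named facts of
`AlterationsSemiStableResolution.lean`. De Jong 1996, 2.4 (p. 55): "let `D ⊂ S` be a normal
crossings divisor; there exists a blowing up `φ : S' → S` with centre in `D` such that `φ⁻¹(D)`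
is a strict normal crossings divisor" (`DeJong1996NormalCrossingsBlowup`). The source gives only
the idea ("blow up the points where `D` has three branches, then blow up the strict transform of
the curves where `D` has two branches, etc."); the decomposition of the tree is:

* `NormalCrossingsStrictification.lean` — the induction on the number of unmarked branches:
  `DeJong1996NormalCrossingsBlowup.of_branchOrderLe_of_step` reduces the statement to the bound
  `NormalCrossingsBranchOrderLe` (PROVED: `NormalCrossingsBranchOrderLe_holds`,
  `EtaleVanishingIdeal.lean`) and the blowing-up step `DeJong1996NormalCrossingsBlowupStep`;
* `NormalCrossingsBlowupStepReduction.lean` — étale descent: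
  `DeJong1996NormalCrossingsBlowupStep.of_sncBlowupTopStratum` reduces the step to the chart
  computation `SNCBlowupTopStratum` for STRICT normal crossings pairs (`SncStrata.lean`,
  `BlowupChartRsop.lean`, `BlowupChartRsopIdeals.lean`, `BlowupStalkCharts.lean`).

This file records the composite reduction
`DeJong1996NormalCrossingsBlowup.of_sncBlowupTopStratum` (PROVED) and, `SNCBlowupTopStratum`
being discharged (`SNCBlowupTopStratum_holds`, `NormalCrossingsBlowupStepReductionProofs.lean`),
the DISCHARGE `DeJong1996NormalCrossingsBlowup_holds` of de Jong 1996, 2.4.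

## Sources

* A. J. de Jong, *Smoothness, semi-stability and alterations*, Publ. Math. IHÉS 83 (1996) 51–93,
  2.4 (p. 55). [DeJong1996]
-/

noncomputable section

open CategoryTheory AlgebraicGeometry

namespace Literature.AlgebraicGeometry.Resolution

universe u

/-- **De Jong 1996, 2.4 from the chart computation**: the statement
`DeJong1996NormalCrossingsBlowup` (every normal crossings divisor on a Noetherian scheme becomes a
strict normal crossings divisor after a blowing up with centre in it) follows from the blowing-up
step for strict normal crossings pairs `SNCBlowupTopStratum`, through the induction on unmarked
branches (`DeJong1996NormalCrossingsBlowup.of_branchOrderLe_of_step`, with the bound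
`NormalCrossingsBranchOrderLe_holds`) and étale descent
(`DeJong1996NormalCrossingsBlowupStep.of_sncBlowupTopStratum`). [cite: DeJong1996, 2.4, p. 55] -/
theorem DeJong1996NormalCrossingsBlowup.of_sncBlowupTopStratum (h : SNCBlowupTopStratum.{u}) :
    DeJong1996NormalCrossingsBlowup.{u} :=
  DeJong1996NormalCrossingsBlowup.of_branchOrderLe_of_step NormalCrossingsBranchOrderLe_holds
    (DeJong1996NormalCrossingsBlowupStep.of_sncBlowupTopStratum h)

/-- **De Jong 1996, 2.4 — DISCHARGE of `DeJong1996NormalCrossingsBlowup`**: "let `D ⊂ S` be a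
normal crossings divisor; there exists a blowing up `φ : S' → S` with centre in `D` such that
`φ⁻¹(D)` is a strict normal crossings divisor", as rendered in
`AlterationsSemiStableResolution.lean`; from the induction on unmarked branches
(`DeJong1996NormalCrossingsBlowup.of_branchOrderLe_of_step`, bound
`NormalCrossingsBranchOrderLe_holds`) and the discharged blowing-up step
(`DeJong1996NormalCrossingsBlowupStep_holds`, i.e. `SNCBlowupTopStratum_holds` and étale descent).
[cite: DeJong1996, 2.4, p. 55] -/
theorem DeJong1996NormalCrossingsBlowup_holds : DeJong1996NormalCrossingsBlowup.{u} :=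
  DeJong1996NormalCrossingsBlowup.of_branchOrderLe_of_step NormalCrossingsBranchOrderLe_holds
    DeJong1996NormalCrossingsBlowupStep_holds

end Literature.AlgebraicGeometry.Resolution

end
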